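import Mathlib
import Summits.KontsevichZagierPeriods.Zeta5Search.FourthDigitVTransport
import Summits.KontsevichZagierPeriods.Zeta5Search.FourthDigitWProof
import HarnessLib

/-!
# ζ(5) search — (V4): the FOURTH digit of the constant-term piece `V_x`, classwise (PROVED)

Cell `pub-zeta5` (HONEST FRAMING: systematic search; no irrationality claim unless certified), gen-2 seat generation 15
(REPORT-gen2-g15 §4; typer g13's L5 work split, INBOX 2026-08-21T03:16Z).  We prove `SecondResidueLaw.FourthDigitV` (gen-2 g13,
`SecondResidueLaw.lean` §1): for admissible `b`, a prime `p ≥ 5` with `b₀ + 2 < p²`, and a residue class with base `x < p`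
containing a pole and with `E = E_x ≤ −4`,
**`v_p( V_x − (−p)^E ĝ_x (v̂_x − pφ_x v̂₂,x + p²c_x v̂₃,x − p³c₃,x v̂₄,x − p³λ_p ŵ_x) ) ≥ E + 4`**, `λ_p = H⁽²⁾_{p−1}/(2p)`
(`fourthDigitV_holds`) — one digit beyond `ThirdDigitVProof.thirdDigitV_holds` (typer g12), whose proof this file clones.

## Proof

Write `H⁽σ⁾_s = p^{−σ}H⁽σ⁾_ℓ + N_{s,σ}` (`s = x + ℓp`).  The LEVEL part carries the fourth-order digit of `c_{σ−1,s}`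
(`FourthDigitSeries.leadingDigit₄`, units moved to the base by `FourthOrderTransport.fourthOrder_transport_bound`) and produces the
model `(−p)^E ĝ_x (v̂ − pφv̂₂ + p²cv̂₃ − p³c₃v̂₄)` termwise.  In the PRIME-TO-`p` part the orders `σ = 1, 2, 3` survive modulo
`p^{E+4}`: `N_{s,1} ≡ H_x − ℓpH⁽²⁾_x + ℓ²p²(H⁽³⁾_x − λ_p) (mod p³)`, `N_{s,2} ≡ H⁽²⁾_x − 2ℓp(H⁽³⁾_x − λ_p) (mod p²)`, `N_{s,3} ≡ H⁽³⁾_x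
(mod p)` (`FourthDigitVTransport`, from gen-2 g14's `HarmonicPrimeToPThird` + cubic Wolstenholme); the resulting corrections
(`FourthDigitVTransport.vCorr`: `corrZero_bound₄`, and typer g12's `corrOne_bound` / `corrTwo_bound` one power of `p` up) sum over
the class, by the residue identities `Σρ₁ = 0`, `Σ(ρ₂ + ℓρ₁) = 0`, `Σ(ρ₃ + 2ℓρ₂ + ℓ²ρ₁) = 0` (`E ≤ −4`), to EXACTLY
`−(−p)^E ĝ_x p³λ_p ŵ_x` (`vCorr_classSum`) — the `λ_p`-term.  `p`-adic valuations of rational numbers; nothing here concerns irrationality.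
-/

noncomputable section

open Finset PowerSeries

namespace Summit.KontsevichZagierPeriods.Zeta5Search.SecondOrder

open Summit.KontsevichZagierPeriods.Zeta5Search.DualSeries (InBox)
open Summit.KontsevichZagierPeriods.Zeta5Search.WedgeDictionary (pfData)
open Summit.KontsevichZagierPeriods.Zeta5Search.CasoratianValuation (InPolytope)
open Summit.KontsevichZagierPeriods.Zeta5Search.ClusterValuation
open Summit.KontsevichZagierPeriods.Zeta5Search.PadicSeries
open Summit.KontsevichZagierPeriods.Zeta5Search.CellA (padicNorm_classRho_le_one pfData_eq_zero_of_order_le gHat_classCongr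
  padicNorm_pow_eq padicNorm_mul_sub_mul_le padicNorm_p padicNorm_inv_sub_inv_le padicNorm_harm_sub_level_le_one harm_succ
  sum_Icc_one_eq_sum_range_six padicNorm_harm_le_one padicNorm_p_pow)
open Summit.KontsevichZagierPeriods.Zeta5Search.BigPrime (padicNorm_mul_le_one)
open Summit.KontsevichZagierPeriods.Zeta5Search.SecondResidueLaw (cubicHat vHat4 predV4 lambdaP FourthDigitV)
open Literature.NumberTheory.Transcendental.BallRivoal (harm)

variable {p : ℕ} [hp : Fact p.Prime]

/-! ### (V4) -/

/-- **(V4), PROVED: the fourth digit of `V_x`** (`SecondResidueLaw.FourthDigitV`): for admissible `b`, a prime `p ≥ 5` with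
`b₀ + 2 < p²`, a class with base `x < p` containing a pole and `E_x ≤ −4`,
`v_p( V_x − (−p)^E ĝ_x (v̂ − pφv̂₂ + p²cv̂₃ − p³c₃v̂₄ − p³λ_pŵ) ) ≥ E + 4` (when the difference is nonzero). -/
theorem fourthDigitV_holds : FourthDigitV := by
  intro b p x hb hprime hp5 hwin hx hpole hE4 hne
  haveI : Fact p.Prime := ⟨hprime⟩
  obtain ⟨hbox, -, -, hn⟩ := thmA_data b hb hwin
  have h0 : 0 ≤ b 0 := hbox.1
  have hp2 : p ≠ 2 := by omega
  have hp0 : (p : ℚ) ≠ 0 := Nat.cast_ne_zero.2 hprime.ne_zero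
  have hp' : (-(p : ℚ)) ≠ 0 := neg_ne_zero.2 hp0
  have hxmem : x ∈ classSet b p x := base_mem_classSet b hx hpole
  rw [predV4, cubicHat_eq] at hne ⊢
  set E := classExp b p x with hE
  set g := gHat b p x with hg
  set c₃ := (phiHat b p x ^ 3 - 3 * phiHat b p x * phi2Hat b p x + 2 * phi3Expl b p x) / 6 with hc₃
  set φ := phiHat b p x with hφ
  set cc := curvHat b p x with hcc
  set Hx := harm 1 x with hHx
  set Hx2 := harm 2 x with hHx2
  set Hx3 := harm 3 x with hHx3
  set lam := lambdaP p with hlamdef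
  -- the model summands
  set F1 : ℕ → ℕ → ℚ := fun s σ => (-1 : ℚ) ^ σ * classRho b p s σ * harm σ (s / p) with hF1
  set F2 : ℕ → ℕ → ℚ := fun s σ => (-1 : ℚ) ^ σ * (((s / p : ℕ) : ℚ) * classRho b p s σ
      + (if (σ : ℤ) + 1 ≤ -netExp b s then classRho b p s (σ + 1) else 0)) * harm σ (s / p) with hF2
  set F3 : ℕ → ℕ → ℚ := fun s σ => (-1 : ℚ) ^ σ * (((s / p : ℕ) : ℚ) ^ 2 * classRho b p s σ
      + (if (σ : ℤ) + 1 ≤ -netExp b s then 2 * ((s / p : ℕ) : ℚ) * classRho b p s (σ + 1) else 0)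
      + (if (σ : ℤ) + 2 ≤ -netExp b s then classRho b p s (σ + 2) else 0)) * harm σ (s / p) with hF3
  set F4 : ℕ → ℕ → ℚ := fun s σ => (-1 : ℚ) ^ σ * (((s / p : ℕ) : ℚ) ^ 3 * classRho b p s σ
      + (if (σ : ℤ) + 1 ≤ -netExp b s then 3 * ((s / p : ℕ) : ℚ) ^ 2 * classRho b p s (σ + 1) else 0)
      + (if (σ : ℤ) + 2 ≤ -netExp b s then 3 * ((s / p : ℕ) : ℚ) * classRho b p s (σ + 2) else 0)
      + (if (σ : ℤ) + 3 ≤ -netExp b s then classRho b p s (σ + 3) else 0)) * harm σ (s / p) with hF4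
  -- v̂, v̂₂, v̂₃, v̂₄ as double sums over the whole class and `o < 6`
  have h6 : ∀ s, (-netExp b s).toNat ≤ 6 := fun s => by
    have := blockCount_le b s; unfold netExp; split_ifs <;> omega
  have hIcc : ∀ (F : ℕ → ℕ → ℚ) s, (∑ σ ∈ Icc 1 (-netExp b s).toNat, F s σ) =
      ∑ o ∈ range 6, (if (o : ℤ) + 1 ≤ -netExp b s then F s (o + 1) else 0) := by
    intro F s
    rw [sum_Icc_one_eq_sum_range_six (h6 s)]
    refine sum_congr rfl fun o _ => ?_
    have : (o + 1 ≤ (-netExp b s).toNat) ↔ ((o : ℤ) + 1 ≤ -netExp b s) := by omega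
    simp only [this]
  have hpoles : ∀ (F : ℕ → ℕ → ℚ), (∑ s ∈ classPoles b p x, ∑ σ ∈ Icc 1 (-netExp b s).toNat, F s σ) =
      ∑ s ∈ classSet b p x, ∑ o ∈ range 6, (if (o : ℤ) + 1 ≤ -netExp b s then F s (o + 1) else 0) := by
    intro F
    rw [classPoles, sum_filter]
    refine sum_congr rfl fun s _ => ?_
    split_ifs with hpole'
    · exact hIcc F s
    · refine (sum_eq_zero fun o _ => ?_).symm
      rw [if_neg (by omega)]
  have hv : vHat b p x = ∑ s ∈ classSet b p x, ∑ o ∈ range 6,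
      (if (o : ℤ) + 1 ≤ -netExp b s then F1 s (o + 1) else 0) := by
    rw [vHat]; exact hpoles F1
  have hv2 : vHat2 b p x = ∑ s ∈ classSet b p x, ∑ o ∈ range 6,
      (if (o : ℤ) + 1 ≤ -netExp b s then F2 s (o + 1) else 0) := by
    rw [vHat2]; exact hpoles F2
  have hv3 : vHat3 b p x = ∑ s ∈ classSet b p x, ∑ o ∈ range 6,
      (if (o : ℤ) + 1 ≤ -netExp b s then F3 s (o + 1) else 0) := by
    rw [vHat3]; exact hpoles F3
  have hv4 : vHat4 b p x = ∑ s ∈ classSet b p x, ∑ o ∈ range 6,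
      (if (o : ℤ) + 1 ≤ -netExp b s then F4 s (o + 1) else 0) := by
    rw [vHat4]; exact hpoles F4
  -- the termwise model and the harmonic corrections at σ = 1, 2, 3
  set A : ℕ → ℕ → ℚ := fun s o => pfData b o s * harm (o + 1) s - (-(p : ℚ)) ^ E * g *
      ((if (o : ℤ) + 1 ≤ -netExp b s then F1 s (o + 1) else 0)
        - (p : ℚ) * φ * (if (o : ℤ) + 1 ≤ -netExp b s then F2 s (o + 1) else 0)
        + (p : ℚ) ^ 2 * cc * (if (o : ℤ) + 1 ≤ -netExp b s then F3 s (o + 1) else 0)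
        - (p : ℚ) ^ 3 * c₃ * (if (o : ℤ) + 1 ≤ -netExp b s then F4 s (o + 1) else 0)) with hA
  set Cr : ℕ → ℕ → ℚ := vCorr b p E g φ cc Hx Hx2 Hx3 lam with hCr
  have hsplit : classV b p x - (-(p : ℚ)) ^ E * g * (vHat b p x - (p : ℚ) * φ * vHat2 b p x + (p : ℚ) ^ 2 * cc * vHat3 b p x
      - (p : ℚ) ^ 3 * c₃ * vHat4 b p x) = ∑ s ∈ classSet b p x, ∑ o ∈ range 6, A s o := by
    rw [hv, hv2, hv3, hv4, classV]
    refine (sum_lincomb_four _ _ _ _ _ _ _ _ _ _).trans ?_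
    exact sum_congr rfl fun s _ => sum_lincomb_four _ _ _ _ _ _ _ _ _ _
  -- the corrections total `(−p)^{E+1} ĝ p²λ ŵ = −(−p)^E ĝ p³λ ŵ` (residue identities, E ≤ -4)
  have hCsum : ∑ s ∈ classSet b p x, ∑ o ∈ range 6, Cr s o = (-(p : ℚ)) ^ (E + 1) * g * ((p : ℚ) ^ 2 * lam * wHat b p x) :=
    vCorr_classSum b hb hp5 hwin hx hE4 g φ cc Hx Hx2 Hx3 lam
  have hsplit' : classV b p x - (-(p : ℚ)) ^ E * g * (vHat b p x - (p : ℚ) * φ * vHat2 b p x + (p : ℚ) ^ 2 * cc * vHat3 b p x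
      - (p : ℚ) ^ 3 * c₃ * vHat4 b p x - (p : ℚ) ^ 3 * lam * wHat b p x) =
      ∑ s ∈ classSet b p x, ∑ o ∈ range 6, (A s o - Cr s o) := by
    have e1 : classV b p x - (-(p : ℚ)) ^ E * g * (vHat b p x - (p : ℚ) * φ * vHat2 b p x + (p : ℚ) ^ 2 * cc * vHat3 b p x
        - (p : ℚ) ^ 3 * c₃ * vHat4 b p x - (p : ℚ) ^ 3 * lam * wHat b p x) =
        (classV b p x - (-(p : ℚ)) ^ E * g * (vHat b p x - (p : ℚ) * φ * vHat2 b p x + (p : ℚ) ^ 2 * cc * vHat3 b p x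
          - (p : ℚ) ^ 3 * c₃ * vHat4 b p x)) + (-(p : ℚ)) ^ E * g * ((p : ℚ) ^ 3 * lam * wHat b p x) := by ring
    have e2 : ∑ s ∈ classSet b p x, ∑ o ∈ range 6, (A s o - Cr s o) =
        (∑ s ∈ classSet b p x, ∑ o ∈ range 6, A s o) - ∑ s ∈ classSet b p x, ∑ o ∈ range 6, Cr s o := by
      rw [← sum_sub_distrib]; refine sum_congr rfl fun s _ => sum_sub_distrib _ _
    rw [e1, e2, hsplit, hCsum, zpow_add_one₀ hp' E]; ring
  -- common norms
  have hpowE : padicNorm p ((-(p : ℚ)) ^ E) = (p : ℚ) ^ (-E) := by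
    rw [padicNorm.eq_zpow_of_nonzero (zpow_ne_zero _ hp'), padicValRat.zpow, padicValRat.neg,
      padicValRat.self hprime.one_lt, mul_one]
  have hgx1 : padicNorm p g ≤ 1 := (padicNorm_gHat_class b hb hp5 hx hxmem hxmem).1
  have hφ1 : padicNorm p φ ≤ 1 := padicNorm_phiHat_le_one b hp2 x
  have hcc1 : padicNorm p cc ≤ 1 := padicNorm_curvHat_le_one b hp2 x
  have hHx1 : padicNorm p Hx ≤ 1 := padicNorm_harm_le_one hx 1
  have hHx21 : padicNorm p Hx2 ≤ 1 := padicNorm_harm_le_one hx 2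
  have hHx31 : padicNorm p Hx3 ≤ 1 := padicNorm_harm_le_one hx 3
  have hlam1 : padicNorm p lam ≤ 1 := padicNorm_lambdaP_le_one hp5
  have hH2' : padicNorm p (2 * (Hx3 - lam)) ≤ 1 := padicNorm_mul_le_one (padicNorm_ofNat_le_one 2) (CellA.nI_sub hHx31 hlam1)
  -- termwise bound `p^{-(E+4)}`
  have hterm : ∀ s ∈ classSet b p x, ∀ o ∈ range 6, padicNorm p (A s o - Cr s o) ≤ (p : ℚ) ^ (-(E + 4)) := by
    intro s hs o ho
    have hsn : s ≤ (b 0).toNat := ((mem_classSet_iff b x s).1 hs).1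
    have hsx : s % p = x := by rw [(mem_filter.1 hs).2, Nat.mod_eq_of_lt hx]
    have ho' := mem_range.1 ho
    have hEs : classExp b p s = E := classExp_eq_of_mem hs
    by_cases hord : (o : ℤ) + 1 ≤ -netExp b s
    · -- `s` is a pole of order ≥ σ = o + 1
      have hAs : A s o = pfData b o s * harm (o + 1) s - (-(p : ℚ)) ^ E * g *
          ((-1 : ℚ) ^ (o + 1) * classRho b p s (o + 1) * harm (o + 1) (s / p) - (p : ℚ) * φ *
            ((-1 : ℚ) ^ (o + 1) * (((s / p : ℕ) : ℚ) * classRho b p s (o + 1)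
              + (if ((o + 1 : ℕ) : ℤ) + 1 ≤ -netExp b s then classRho b p s (o + 1 + 1) else 0)) * harm (o + 1) (s / p))
            + (p : ℚ) ^ 2 * cc * ((-1 : ℚ) ^ (o + 1) * (((s / p : ℕ) : ℚ) ^ 2 * classRho b p s (o + 1)
              + (if ((o + 1 : ℕ) : ℤ) + 1 ≤ -netExp b s then 2 * ((s / p : ℕ) : ℚ) * classRho b p s (o + 1 + 1) else 0)
              + (if ((o + 1 : ℕ) : ℤ) + 2 ≤ -netExp b s then classRho b p s (o + 1 + 2) else 0)) * harm (o + 1) (s / p))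
            - (p : ℚ) ^ 3 * c₃ * ((-1 : ℚ) ^ (o + 1) * (((s / p : ℕ) : ℚ) ^ 3 * classRho b p s (o + 1)
              + (if ((o + 1 : ℕ) : ℤ) + 1 ≤ -netExp b s then 3 * ((s / p : ℕ) : ℚ) ^ 2 * classRho b p s (o + 1 + 1) else 0)
              + (if ((o + 1 : ℕ) : ℤ) + 2 ≤ -netExp b s then 3 * ((s / p : ℕ) : ℚ) * classRho b p s (o + 1 + 2) else 0)
              + (if ((o + 1 : ℕ) : ℤ) + 3 ≤ -netExp b s then classRho b p s (o + 1 + 3) else 0)) * harm (o + 1) (s / p))) := by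
        simp only [hA, hF1, hF2, hF3, hF4, if_pos hord]
      have hρ'2 : (if ((o + 1 : ℕ) : ℤ) + 1 ≤ -netExp b s then 2 * ((s / p : ℕ) : ℚ) * classRho b p s (o + 1 + 1) else 0)
          = 2 * ((s / p : ℕ) : ℚ) * (if ((o + 1 : ℕ) : ℤ) + 1 ≤ -netExp b s then classRho b p s (o + 1 + 1) else 0) := by
        split_ifs <;> ring
      have hρ'3 : (if ((o + 1 : ℕ) : ℤ) + 1 ≤ -netExp b s then 3 * ((s / p : ℕ) : ℚ) ^ 2 * classRho b p s (o + 1 + 1) else 0)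
          = 3 * ((s / p : ℕ) : ℚ) ^ 2 * (if ((o + 1 : ℕ) : ℤ) + 1 ≤ -netExp b s then classRho b p s (o + 1 + 1) else 0) := by
        split_ifs <;> ring
      have hρ''3 : (if ((o + 1 : ℕ) : ℤ) + 2 ≤ -netExp b s then 3 * ((s / p : ℕ) : ℚ) * classRho b p s (o + 1 + 2) else 0)
          = 3 * ((s / p : ℕ) : ℚ) * (if ((o + 1 : ℕ) : ℤ) + 2 ≤ -netExp b s then classRho b p s (o + 1 + 2) else 0) := by
        split_ifs <;> ring
      rw [hρ'2, hρ'3, hρ''3] at hAs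
      set σ := o + 1 with hσ
      set c := pfData b o s with hc
      set gs := gHat b p s with hgs
      set φs := phiHat b p s with hφs
      set cs := curvHat b p s with hcs
      set c₃s := (phiHat b p s ^ 3 - 3 * phiHat b p s * phi2Hat b p s + 2 * phi3Expl b p s) / 6 with hc₃s
      set ρ := classRho b p s σ with hρdef
      set ρ' : ℚ := if (σ : ℤ) + 1 ≤ -netExp b s then classRho b p s (σ + 1) else 0 with hρ'
      set ρ'' : ℚ := if (σ : ℤ) + 2 ≤ -netExp b s then classRho b p s (σ + 2) else 0 with hρ''
      set ρ''' : ℚ := if (σ : ℤ) + 3 ≤ -netExp b s then classRho b p s (σ + 3) else 0 with hρ'''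
      set Hs := harm σ s with hHs
      set Hl := harm σ (s / p) with hHl
      set ℓ : ℚ := ((s / p : ℕ) : ℚ) with hℓ
      set N := Hs - Hl / (p : ℚ) ^ σ with hN
      -- ingredients
      have hD : padicNorm p (c - (-(p : ℚ)) ^ ((σ : ℤ) + E) * gs *
          (ρ - (p : ℚ) * φs * ρ' + (p : ℚ) ^ 2 * cs * ρ'' - (p : ℚ) ^ 3 * c₃s * ρ''')) ≤ (p : ℚ) ^ (-((σ : ℤ) + E + 4)) := by
        have h := leadingDigit₄ b hb hp5 hwin hsn (σ := σ) (by omega) (by omega)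
        rw [hEs, show σ - 1 = o by omega] at h
        exact h
      have hcA : padicNorm p c ≤ (p : ℚ) ^ (-((σ : ℤ) + E)) := by
        refine padicNorm_le_of_val fun hne' => ?_
        have := clusterBound_holds b p s o hb hprime (by omega) hwin hsn ho' hne'
        rw [hEs] at this; push_cast [hσ]; linarith
      have hρn : padicNorm p ρ ≤ 1 := padicNorm_classRho_le_one b h0 hsn hn hp2 σ
      have hρ'n : padicNorm p ρ' ≤ 1 := by
        rw [hρ']; split_ifs
        · exact padicNorm_classRho_le_one b h0 hsn hn hp2 (σ + 1)
        · simp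
      have hρ''n : padicNorm p ρ'' ≤ 1 := by
        rw [hρ'']; split_ifs
        · exact padicNorm_classRho_le_one b h0 hsn hn hp2 (σ + 2)
        · simp
      have hρ'''n : padicNorm p ρ''' ≤ 1 := by
        rw [hρ''']; split_ifs
        · exact padicNorm_classRho_le_one b h0 hsn hn hp2 (σ + 3)
        · simp
      have hgs1 : padicNorm p gs ≤ 1 := (padicNorm_gHat_class b hb hp5 hx hs hxmem).1
      have hgg : padicNorm p (gs - g) ≤ (p : ℚ) ^ (-(1 : ℤ)) := (padicNorm_gHat_class b hb hp5 hx hs hxmem).2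
      have hφs1 : padicNorm p φs ≤ 1 := padicNorm_phiHat_le_one b hp2 s
      have hφφ : padicNorm p (φs - φ) ≤ (p : ℚ) ^ (-(1 : ℤ)) := padicNorm_phiHat_sub_le b hp2 hs
      have hg2 : padicNorm p (gs - g * (1 - ℓ * p * φ)) ≤ (p : ℚ) ^ (-(2 : ℤ)) := padicNorm_gHat_sub_second_le b hp2 hx hs
      have hlp : s / p < p := Nat.div_lt_of_lt_mul (by nlinarith [hsn, hn])
      have hHl1 : padicNorm p Hl ≤ 1 := padicNorm_harm_le_one hlp σ
      have hN1 : padicNorm p N ≤ 1 := padicNorm_harm_sub_level_le_one σ s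
      have hℓn : padicNorm p ℓ ≤ 1 := by rw [hℓ]; simpa using padicNorm.of_nat (p := p) (s / p)
      have hΔ := fourthOrder_transport_bound b hb hp5 hx hs hρn hρ'n hρ''n hρ'''n
      -- the algebra: A = cN + D·Hl/p^σ + (−1)^σ (−p)^E Hl Δ
      have hzpow : (-(p : ℚ)) ^ ((σ : ℤ) + E) = (-1 : ℚ) ^ σ * (p : ℚ) ^ σ * (-(p : ℚ)) ^ E := by
        rw [zpow_add₀ hp', zpow_natCast, neg_pow]
      have eA : A s o = c * N
          + (c - (-(p : ℚ)) ^ ((σ : ℤ) + E) * gs * (ρ - (p : ℚ) * φs * ρ' + (p : ℚ) ^ 2 * cs * ρ'' - (p : ℚ) ^ 3 * c₃s * ρ'''))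
              / (p : ℚ) ^ σ * Hl
          + (-1 : ℚ) ^ σ * (-(p : ℚ)) ^ E * Hl *
              (gs * (ρ - (p : ℚ) * φs * ρ' + (p : ℚ) ^ 2 * cs * ρ'' - (p : ℚ) ^ 3 * c₃s * ρ''')
                - g * (ρ - (p : ℚ) * φ * (ℓ * ρ + ρ') + (p : ℚ) ^ 2 * cc * (ℓ ^ 2 * ρ + 2 * ℓ * ρ' + ρ'')
                    - (p : ℚ) ^ 3 * c₃ * (ℓ ^ 3 * ρ + 3 * ℓ ^ 2 * ρ' + 3 * ℓ * ρ'' + ρ'''))) := by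
        rw [hAs, hN, hzpow]; field_simp; ring
      have hP2 : padicNorm p ((c - (-(p : ℚ)) ^ ((σ : ℤ) + E) * gs *
          (ρ - (p : ℚ) * φs * ρ' + (p : ℚ) ^ 2 * cs * ρ'' - (p : ℚ) ^ 3 * c₃s * ρ''')) / (p : ℚ) ^ σ * Hl) ≤ (p : ℚ) ^ (-(E + 4)) := by
        rw [padicNorm.mul, padicNorm.div, padicNorm_p_pow]
        calc _ / ((p : ℚ) ^ σ)⁻¹ * padicNorm p Hl ≤ (p : ℚ) ^ (-((σ : ℤ) + E + 4)) / ((p : ℚ) ^ σ)⁻¹ * 1 :=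
              mul_le_mul (div_le_div_of_nonneg_right hD (by positivity)) hHl1 (padicNorm.nonneg _)
                (div_nonneg (zpow_p_nonneg _) (by positivity))
          _ = (p : ℚ) ^ (-(E + 4)) := by
              rw [mul_one, div_inv_eq_mul, ← zpow_natCast, ← zpow_add₀ hp0]; ring_nf
      have hP3 : padicNorm p ((-1 : ℚ) ^ σ * (-(p : ℚ)) ^ E * Hl *
          (gs * (ρ - (p : ℚ) * φs * ρ' + (p : ℚ) ^ 2 * cs * ρ'' - (p : ℚ) ^ 3 * c₃s * ρ''')
            - g * (ρ - (p : ℚ) * φ * (ℓ * ρ + ρ') + (p : ℚ) ^ 2 * cc * (ℓ ^ 2 * ρ + 2 * ℓ * ρ' + ρ'')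
                - (p : ℚ) ^ 3 * c₃ * (ℓ ^ 3 * ρ + 3 * ℓ ^ 2 * ρ' + 3 * ℓ * ρ'' + ρ''')))) ≤ (p : ℚ) ^ (-(E + 4)) := by
        rw [padicNorm.mul, padicNorm.mul, padicNorm.mul, hpowE]
        have h1 : padicNorm p ((-1 : ℚ) ^ σ) = 1 := by rw [padicNorm_pow_eq, padicNorm.neg, padicNorm.one, one_pow]
        rw [h1, one_mul]
        calc (p : ℚ) ^ (-E) * padicNorm p Hl * _ ≤ (p : ℚ) ^ (-E) * 1 * (p : ℚ) ^ (-(4 : ℤ)) :=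
              mul_le_mul (mul_le_mul_of_nonneg_left hHl1 (zpow_p_nonneg _)) hΔ (padicNorm.nonneg _)
                (mul_nonneg (zpow_p_nonneg _) zero_le_one)
          _ = (p : ℚ) ^ (-(E + 4)) := by rw [mul_one, ← zpow_add₀ hp0]; ring_nf
      -- the prime-to-`p` part `cN` against the correction
      have hP1 : padicNorm p (c * N - Cr s o) ≤ (p : ℚ) ^ (-(E + 4)) := by
        by_cases ho0 : o = 0
        · -- σ = 1: Theorem B to third order, third-order transport, `N_{s,1}` mod p³
          have hσ1 : σ = 1 := by omega
          have hneg : netExp b s < 0 := by omega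
          have hρ'e : ρ' = (if netExp b s ≤ -2 then classRho b p s 2 else 0) := by
            rw [hρ', hσ1]
            by_cases h2 : netExp b s ≤ -2
            · rw [if_pos (by omega), if_pos h2]
            · rw [if_neg (by omega), if_neg h2]
          have hρ''e : ρ'' = (if netExp b s ≤ -3 then classRho b p s 3 else 0) := by
            rw [hρ'', hσ1]
            by_cases h3 : netExp b s ≤ -3
            · rw [if_pos (by omega), if_pos h3]
            · rw [if_neg (by omega), if_neg h3]
          have hCrs : Cr s o = (-(p : ℚ)) ^ (E + 1) * g *
              (Hx * ρ - (p : ℚ) * φ * Hx * (ℓ * ρ + ρ') - (p : ℚ) * Hx2 * ℓ * ρ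
                + (p : ℚ) ^ 2 * (cc * Hx * (ℓ ^ 2 * ρ + 2 * ℓ * ρ' + ρ'') + φ * ℓ * Hx2 * (ℓ * ρ + ρ') + ℓ ^ 2 * (Hx3 - lam) * ρ)) := by
            simp only [hCr, vCorr, ho0, hneg, and_self, if_true, hρdef, hσ1, hρ'e, hρ''e, hℓ]
          have hB : padicNorm p (c - (-(p : ℚ)) ^ (E + 1) * gs * (ρ - (p : ℚ) * φs * ρ' + (p : ℚ) ^ 2 * cs * ρ'')) ≤
              (p : ℚ) ^ (-(E + 4)) := by
            have h := leadingDigit₃ b hb hp5 hwin hsn (σ := 1) le_rfl (by omega)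
            have e4 : (if ((1 : ℕ) : ℤ) + 1 ≤ -netExp b s then classRho b p s (1 + 1) else 0) = ρ' := by rw [hρ', hσ1]
            have e5 : (if ((1 : ℕ) : ℤ) + 2 ≤ -netExp b s then classRho b p s (1 + 2) else 0) = ρ'' := by rw [hρ'', hσ1]
            have e6 : classRho b p s 1 = ρ := by rw [hρdef, hσ1]
            rw [e4, e5, e6, hEs, show (1 : ℕ) - 1 = o by omega, show ((1 : ℕ) : ℤ) + E = E + 1 by ring] at h
            rw [show -(E + 4) = -(E + 1 + 3) by ring]
            exact h
          have hΔ3 := thirdOrder_transport_bound b hb hp5 hx hs hρn hρ'n hρ''n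
          have hνN : padicNorm p (N - (Hx - ℓ * p * Hx2 + ℓ ^ 2 * (p : ℚ) ^ 2 * (Hx3 - lam))) ≤ (p : ℚ) ^ (-(3 : ℤ)) := by
            have h := padicNorm_harmN1_sub_lambda_le (p := p) hp5 s
            rw [hsx] at h
            rw [hN, hHs, hHl, hσ1]
            exact h
          rw [hCrs]
          exact corrZero_bound₄ hB hΔ3 hN1 hνN hgx1 hρn hρ'n hρ''n hHx21 hHx31 hlam1 hφ1 hcc1 hℓn
        · by_cases ho1 : o = 1
          · -- σ = 2: Theorem B to second order, `N_{s,2}` mod p² (typer g12's `corrOne_bound`, one power of `p` up)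
            have hσ2 : σ = 2 := by omega
            have hn2 : netExp b s ≤ -2 := by omega
            have hneg : netExp b s < 0 := by omega
            have hρ'e : ρ' = (if netExp b s ≤ -3 then classRho b p s 3 else 0) := by
              rw [hρ', hσ2]
              by_cases h3 : netExp b s ≤ -3
              · rw [if_pos (by omega), if_pos h3]
              · rw [if_neg (by omega), if_neg h3]
            have hCrs : Cr s o = (-(p : ℚ)) ^ (E + 1 + 1) * g *
                (Hx2 * ρ - (p : ℚ) * φ * Hx2 * (ℓ * ρ + ρ') - (p : ℚ) * (2 * (Hx3 - lam)) * ℓ * ρ) := by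
              rw [show E + 1 + 1 = E + 2 by ring]
              simp only [hCr, vCorr, ho1, hneg, hn2, and_self, and_true, if_true, one_ne_zero, if_false, hρdef, hσ2, hρ'e, hℓ]
            have hB : padicNorm p (c - (-(p : ℚ)) ^ (E + 1 + 1) * gs * (ρ - (p : ℚ) * φs * ρ')) ≤ (p : ℚ) ^ (-(E + 1 + 3)) := by
              have h := leadingDigit₂ b hb hp5 hwin hsn (σ := 2) (by norm_num) (by omega)
              have e4 : (if ((2 : ℕ) : ℤ) + 1 ≤ -netExp b s then classRho b p s (2 + 1) else 0) = ρ' := by rw [hρ', hσ2]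
              have e5 : classRho b p s 2 = ρ := by rw [hρdef, hσ2]
              rw [e4, e5, hEs, show (2 : ℕ) - 1 = o by omega, show ((2 : ℕ) : ℤ) + E = E + 1 + 1 by ring] at h
              rw [show -(E + 1 + 3) = -(E + 1 + 1 + 2) by ring]
              exact h
            have hνN : padicNorm p (N - (Hx2 - ℓ * p * (2 * (Hx3 - lam)))) ≤ (p : ℚ) ^ (-(2 : ℤ)) := by
              have h := padicNorm_harmN2_sub_lambda_le (p := p) hp5 s
              rw [hsx] at h
              rw [hN, hHs, hHl, hσ2]
              exact h
            rw [hCrs, show -(E + 4) = -(E + 1 + 3) by ring]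
            exact corrOne_bound hB hN1 hνN hg2 hφφ hgs1 hgx1 hρn hρ'n hHx21 hH2' hφ1 hφs1 hℓn
          · by_cases ho2 : o = 2
            · -- σ = 3: Theorem B to first order, `N_{s,3}` mod p (typer g12's `corrTwo_bound`, one power of `p` up)
              have hσ3 : σ = 3 := by omega
              have hn3 : netExp b s ≤ -3 := by omega
              have hneg : netExp b s < 0 := by omega
              have hCrs : Cr s o = (-(p : ℚ)) ^ (E + 1 + 2) * g * Hx3 * ρ := by
                rw [show E + 1 + 2 = E + 3 by ring]
                simp only [hCr, vCorr, ho2, hneg, hn3, and_true, if_true, (by decide : (2 : ℕ) ≠ 0), (by decide : (2 : ℕ) ≠ 1),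
                  if_false, hρdef, hσ3]
              have hB : padicNorm p (c - (-(p : ℚ)) ^ (E + 1 + 2) * gs * ρ) ≤ (p : ℚ) ^ (-(E + 1 + 3)) := by
                refine padicNorm_le_of_val fun hne' => ?_
                have := leadingDigit_holds b p s 3 hb hprime hp5 hwin hsn (by norm_num) (by omega)
                  (by rw [hEs, show ((3 : ℕ) : ℤ) + E = E + 1 + 2 by ring, show 3 - 1 = o by omega, ← hσ3]; exact hne')
                rw [hEs, show ((3 : ℕ) : ℤ) + E = E + 1 + 2 by ring, show 3 - 1 = o by omega, ← hσ3] at this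
                linarith
              have hNH : padicNorm p (N - Hx3) ≤ (p : ℚ) ^ (-(1 : ℤ)) := by
                have h := padicNorm_harmN3_sub_le (p := p) hp5 s
                rw [hsx] at h
                rw [hN, hHs, hHl, hσ3]
                exact h
              rw [hCrs, show -(E + 4) = -(E + 1 + 3) by ring]
              exact corrTwo_bound hB hN1 hρn hgx1 hgg hNH
            · -- σ ≥ 4: no correction
              have hCrs : Cr s o = 0 := by simp only [hCr, vCorr, ho0, ho1, ho2, false_and, if_false]
              rw [hCrs, sub_zero, padicNorm.mul]
              calc padicNorm p c * padicNorm p N ≤ (p : ℚ) ^ (-((σ : ℤ) + E)) * 1 :=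
                    mul_le_mul hcA hN1 (padicNorm.nonneg _) (zpow_p_nonneg _)
                _ ≤ (p : ℚ) ^ (-(E + 4)) := by rw [mul_one]; exact zpow_le_zpow_right₀ one_le_p (by omega)
      have e2 : A s o - Cr s o = (c * N - Cr s o)
          + (c - (-(p : ℚ)) ^ ((σ : ℤ) + E) * gs * (ρ - (p : ℚ) * φs * ρ' + (p : ℚ) ^ 2 * cs * ρ'' - (p : ℚ) ^ 3 * c₃s * ρ'''))
              / (p : ℚ) ^ σ * Hl
          + (-1 : ℚ) ^ σ * (-(p : ℚ)) ^ E * Hl *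
              (gs * (ρ - (p : ℚ) * φs * ρ' + (p : ℚ) ^ 2 * cs * ρ'' - (p : ℚ) ^ 3 * c₃s * ρ''')
                - g * (ρ - (p : ℚ) * φ * (ℓ * ρ + ρ') + (p : ℚ) ^ 2 * cc * (ℓ ^ 2 * ρ + 2 * ℓ * ρ' + ρ'')
                    - (p : ℚ) ^ 3 * c₃ * (ℓ ^ 3 * ρ + 3 * ℓ ^ 2 * ρ' + 3 * ℓ * ρ'' + ρ'''))) := by
        rw [eA]; ring
      rw [e2]
      exact (padicNorm.nonarchimedean (p := p)).trans
        (max_le ((padicNorm.nonarchimedean (p := p)).trans (max_le hP1 hP2)) hP3)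
    · -- no pole of order ≥ o + 1 at `s`: the model term vanishes, and so does the correction
      have hAs : A s o = 0 := by
        simp only [hA, if_neg hord]
        rw [pfData_eq_zero_of_order_le b hb hsn ho' (by omega)]; ring
      have hCrs : Cr s o = 0 := by
        rw [hCr, vCorr]
        by_cases ho0 : o = 0
        · have hneg : ¬ netExp b s < 0 := by subst ho0; omega
          simp [ho0, hneg]
        · by_cases ho1 : o = 1
          · have h2 : ¬ netExp b s ≤ -2 := by subst ho1; omega
            have h3 : ¬ netExp b s ≤ -3 := by omega
            simp [ho1, h2, h3]
          · by_cases ho2 : o = 2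
            · have h3 : ¬ netExp b s ≤ -3 := by subst ho2; omega
              simp [ho2, h3]
            · simp [ho0, ho1, ho2]
      rw [hAs, hCrs, sub_zero, padicNorm.zero]; exact zpow_p_nonneg _
  apply val_ge_of_padicNorm_le hne
  rw [hsplit']
  exact padicNorm.sum_le' (fun s hs => padicNorm.sum_le' (fun o ho => hterm s hs o ho) (zpow_p_nonneg _)) (zpow_p_nonneg _)

end Summit.KontsevichZagierPeriods.Zeta5Search.SecondOrder

end
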